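import Mathlib
import HarnessLib
import Summits.QuantumFields.YangMills.Theorems.ComplexCouplingChannelContinuumLegGivenGapProductToUniformDefs
import Summits.QuantumFields.YangMills.Theorems.ComplexCouplingChannelContinuumLegGivenGapPtuAssemblyKit

/-!
# `ContinuumLegGivenGap` (stmt-QuantumFields-15828), line `alternating-curvature-arrays`: `stub_ptuAssembly`, the FAR pieces — one piece `(m, v, z)` through the engine and the flat/decay bound

Support file for `stub_ptuAssembly`.  For a far piece `(m, v, z)` of the Whitney system (`…ProductToUniformDefs`) at
step `k`, the lattice sum `∑ₓ (∏ᵢ χᵢ(a_k xᵢ)) ((φ̃/W) • F)(a_k x⃗) c_k(x⃗)` is bounded by the landed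
`localBound_of_productBound` (hypothesis `hLB`: the engine body for `s, t, K`) with the inner cut-offs `ptuChi` and the
inner clause of (PB) at `k` (hypothesis `hPB`), and the Schwartz norm of `(φ̃/W) • F` by the abstract flat/decay bound of
piece 3 (hypothesis `hFlat`), fed with the derivative bounds of piece 2 and the geometry of piece 1 (all as hypotheses on
this one piece): `ptuFar_core` (any flat order `M'`, any extra decay `K₂`).  Geometry used: the point of the cell boxes
closest to the origin has the least norm on the boxes (`ptuFar_norm_boxPoint_le`), and two cells `≥ 16` indices apart keep
their points `≥ 15ℓ` apart, so `‖y‖ ≥ 7ℓ` (`ptuFar_seven_ell_le`, registered anchor).  Constants are written out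
(`c' = max c₂ 1`, `M = c' (c' (p+1)(s+1)^4)^s`, `A₈ = c' (p+1)^8 (pt+1)^8`); no definitions. [folklore]
-/

set_option autoImplicit false

noncomputable section

open scoped Classical

namespace Summit.QuantumFields.YangMills.Theorems.ContinuumLegGivenGap

open scoped SchwartzMap BigOperators ContDiff
open MeasureTheory Filter Topology
open Literature.MathematicalPhysics.QuantumFieldTheory Literature.MathematicalPhysics.QuantumLattice
  Literature.MathematicalPhysics.AQFT
open Literature.Probability.LatticeModels (box Site)
open Summit.QuantumFields.YangMills.Cruxes.ContinuumLimitOnTrajectory.TwoOrbitSynchronisation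
  (PlaqIdx plaq canonDistribution)
open Summit.QuantumFields.YangMills.Theorems.ContinuumLimitExists.Negative (centredMoment)
open Summit.QuantumFields.YangMills.Theorems.ContinuumLegGivenGap.AlternatingArrays (cellSide cellNorm physCore)

/-! ## §1 The box point closest to the origin; separation of distinct cells -/

/-- The point of `[lo, hi]` closest to `0`, `max lo (min 0 hi)`, lies in the interval (`lo ≤ hi`). [folklore] -/
theorem ptuFar_clamp_mem {lo hi : ℝ} (h : lo ≤ hi) : lo ≤ max lo (min 0 hi) ∧ max lo (min 0 hi) ≤ hi :=
  ⟨le_max_left _ _, max_le h (min_le_right _ _)⟩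

/-- `max lo (min 0 hi)` is the point of the interval of least modulus. [folklore] -/
theorem ptuFar_abs_clamp_le {lo hi t : ℝ} (h1 : lo ≤ t) (h2 : t ≤ hi) : |max lo (min 0 hi)| ≤ |t| := by
  rcases le_or_gt 0 hi with hhi | hhi
  · rw [min_eq_left hhi]
    rcases le_or_gt lo 0 with hlo | hlo
    · rw [max_eq_right hlo, abs_zero]; exact abs_nonneg _
    · rw [max_eq_left hlo.le, abs_of_pos hlo, abs_of_pos (hlo.trans_le h1)]; exact h1
  · rw [min_eq_right hhi.le, max_eq_right (h1.trans h2), abs_of_neg hhi, abs_of_neg (h2.trans_lt hhi)]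
    linarith

/-- The cell boxes are genuine intervals (`a ≥ 0`). [folklore] -/
theorem ptuFar_lo_le_hi {a : ℝ} (ha : 0 ≤ a) (m : ℕ) (vμ zμ : ℤ) :
    a * ((vμ : ℝ) + cellSide m * (zμ : ℝ)) ≤ a * ((vμ : ℝ) + cellSide m * ((zμ : ℝ) + 1)) := by
  have hS : 0 ≤ cellSide m := by unfold cellSide; positivity
  nlinarith

/-- **The box point** `g i μ = max lo (min 0 hi)` of the product of cell boxes `∏ᵢ a·[v + S zᵢ, v + S(zᵢ+1)]` lies in the
boxes (`a ≥ 0`). [folklore] -/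
theorem ptuFar_boxPoint_mem {a : ℝ} (ha : 0 ≤ a) (m p : ℕ) (v : Fin 4 → ℤ) (z : Fin p → Fin 4 → ℤ) (i : Fin p)
    (μ : Fin 4) :
    a * ((v μ : ℝ) + cellSide m * (z i μ : ℝ)) ≤ (fun i : Fin p => (WithLp.toLp 2 (fun μ : Fin 4 => max (a * ((v μ : ℝ) + cellSide m * (z i μ : ℝ))) (min 0 (a * ((v μ : ℝ) + cellSide m * ((z i μ : ℝ) + 1))))) : EuclideanSpace ℝ (Fin 4))) i μ ∧
      (fun i : Fin p => (WithLp.toLp 2 (fun μ : Fin 4 => max (a * ((v μ : ℝ) + cellSide m * (z i μ : ℝ))) (min 0 (a * ((v μ : ℝ) + cellSide m * ((z i μ : ℝ) + 1))))) : EuclideanSpace ℝ (Fin 4))) i μ ≤ a * ((v μ : ℝ) + cellSide m * ((z i μ : ℝ) + 1)) := by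
  exact ptuFar_clamp_mem (ptuFar_lo_le_hi ha m _ _)

/-- **The box point has the least norm**: every configuration in the cell boxes has `‖g‖ ≤ ‖y‖`. [folklore] -/
theorem ptuFar_norm_boxPoint_le (a : ℝ) (m p : ℕ) (v : Fin 4 → ℤ) (z : Fin p → Fin 4 → ℤ)
    {y : (Fin p → EuclideanSpace ℝ (Fin 4))}
    (hy : ∀ (i : Fin p) (μ : Fin 4), a * ((v μ : ℝ) + cellSide m * (z i μ : ℝ)) ≤ y i μ ∧ y i μ ≤ a * ((v μ : ℝ) + cellSide m * ((z i μ : ℝ) + 1))) :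
    ‖(fun i : Fin p => (WithLp.toLp 2 (fun μ : Fin 4 => max (a * ((v μ : ℝ) + cellSide m * (z i μ : ℝ))) (min 0 (a * ((v μ : ℝ) + cellSide m * ((z i μ : ℝ) + 1))))) : EuclideanSpace ℝ (Fin 4)))‖ ≤ ‖y‖ := by
  refine (pi_norm_le_iff_of_nonneg (norm_nonneg _)).2 fun i => le_trans ?_ (norm_le_pi_norm y i)
  rw [EuclideanSpace.norm_eq, EuclideanSpace.norm_eq]
  refine Real.sqrt_le_sqrt (Finset.sum_le_sum fun μ _ => ?_)
  rw [Real.norm_eq_abs, Real.norm_eq_abs, PiLp.toLp_apply]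
  exact pow_le_pow_left₀ (abs_nonneg _) (ptuFar_abs_clamp_le (hy i μ).1 (hy i μ).2) 2

/-- **Separation of distinct cells** (registered anchor).  If every point of the configuration `y` lies in its cell box
(cells of physical side `ℓ = a · cellSide m`, common offset `v`) and two cell indices are `≥ 16` apart in sup norm, then
`7ℓ ≤ ‖y‖` (the two points are `≥ 15ℓ` apart, so one of them has norm `≥ 7.5ℓ`). [folklore] -/
theorem ptuFar_seven_ell_le : ∀ (a : ℝ) (m p : ℕ) (v : Fin 4 → ℤ) (z : Fin p → Fin 4 → ℤ)
    (y : Fin p → EuclideanSpace ℝ (Fin 4)) (i j : Fin p), 0 < a →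
    (∀ (i : Fin p) (μ : Fin 4), a * ((v μ : ℝ) + cellSide m * (z i μ : ℝ)) ≤ y i μ ∧
      y i μ ≤ a * ((v μ : ℝ) + cellSide m * ((z i μ : ℝ) + 1))) →
    (16 : ℝ) ≤ ‖z i - z j‖ → 7 * (a * cellSide m) ≤ ‖y‖ := by
  intro a m p v z y i j ha hy hz
  obtain ⟨μ, hμ⟩ := Summit.QuantumFields.YangMills.Theorems.OSLegsFromFemtoAndGap.exists_norm_eq_abs_coord (z i - z j)
  rw [hμ, Pi.sub_apply, Int.cast_sub] at hz
  set S : ℝ := cellSide m with hS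
  have hS0 : 0 < S := by rw [hS]; unfold cellSide; positivity
  have hℓ : 0 < a * S := mul_pos ha hS0
  obtain ⟨h1, h2⟩ := hy i μ
  obtain ⟨h3, h4⟩ := hy j μ
  have hdiff : 15 * (a * S) ≤ |y i μ - y j μ| := by
    rcases le_abs'.1 hz with hneg | hpos
    · have : y i μ - y j μ ≤ a * S * ((z i μ : ℝ) - z j μ + 1) := by nlinarith
      have h5 : a * S * ((z i μ : ℝ) - z j μ + 1) ≤ -(15 * (a * S)) := by nlinarith
      rw [abs_of_nonpos (by linarith)]
      linarith
    · have : a * S * ((z i μ : ℝ) - z j μ - 1) ≤ y i μ - y j μ := by nlinarith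
      have h5 : 15 * (a * S) ≤ a * S * ((z i μ : ℝ) - z j μ - 1) := by nlinarith
      rw [abs_of_nonneg (by linarith)]
      linarith
  have h6 : |y i μ - y j μ| ≤ ‖y i‖ + ‖y j‖ := by
    calc |y i μ - y j μ| ≤ |y i μ| + |y j μ| := abs_sub _ _
      _ ≤ ‖y i‖ + ‖y j‖ := add_le_add (by simpa using PiLp.norm_apply_le (y i) μ)
          (by simpa using PiLp.norm_apply_le (y j) μ)
  have h7 : ‖y i‖ + ‖y j‖ ≤ 2 * ‖y‖ := by linarith [norm_le_pi_norm y i, norm_le_pi_norm y j]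
  linarith

/-! ## §2 One far piece: the engine, then the flat/decay bound -/

section Piece

variable {G : Type} [Group G] [TopologicalSpace G] [IsTopologicalGroup G] [CompactSpace G]
  [MeasurableSpace G] [BorelSpace G]

/-- **The core estimate of one far piece** (any flat order `M'`, any extra decay `K₂`): the engine `hLB` with the inner
cut-offs `ptuChi` (bounds of piece 2 dominated by `M = c' (c' (p+1)(s+1)^4)^s`, `c' = max c₂ 1`), then the flat/decay
bound `hFlat` for the weight `φ̃/W` (bounds of piece 2 dominated by `A₈/ℓ`, `A₈ = c' (p+1)^8 (pt+1)^8`; closeness `240ℓ`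
and the lower bound `max ‖g‖ (7ℓ)` of `‖y‖` on the support from piece 1's geometry, `g` the box point). [folklore] -/
theorem ptuFar_core (r : LatticeRep G) (sch : SpeciesScheme (YMSpecies G)) (k p : ℕ)
    (q : Fin p → PlaqIdx) (F : 𝓢((Fin p → EuclideanSpace ℝ (Fin 4)), ℂ)) (hF : IsOffDiagonal F) (m : ℕ) (v : Fin 4 → ℤ)
    (z : Fin p → Fin 4 → ℤ) {C K c₂ : ℝ} {p₀ s t : ℕ} (hC : 0 ≤ C) (hK : 0 ≤ K) (hc₂ : 0 < c₂) (hp : 1 ≤ p)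
    (hLB : (∀ (G' : Type) [Group G'] [TopologicalSpace G'] [IsTopologicalGroup G'] [CompactSpace G'] [MeasurableSpace G']
      [BorelSpace G'] (r : LatticeRep G') (sch : SpeciesScheme (YMSpecies G')) (k p : ℕ) (q : Fin p → PlaqIdx) (m : ℕ)
      (v : Fin 4 → ℤ) (z : Fin p → Fin 4 → ℤ) (C M : ℝ) (p₀ : ℕ) (χ : Fin p → 𝓢(EuclideanSpace ℝ (Fin 4), ℝ)),
      0 ≤ C → 0 ≤ M →
      (∀ (f : Fin p → 𝓢(EuclideanSpace ℝ (Fin 4), ℝ)) (F : 𝓢((Fin p → EuclideanSpace ℝ (Fin 4)), ℂ)),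
        (∀ i, tsupport (f i) ⊆ physCore (sch.a k) m v (z i)) → IsTensorOf F (fun i => ofRealTest (f i)) →
        ‖canonDistribution r sch k p (fun i => plaq r (q i)) F‖ ≤
          ∏ i, C * max (sch.a k * cellSide m) (sch.a k * cellSide m)⁻¹ ^ p₀ *
            cellNorm s (sch.a k * cellSide m) (f i)) →
      (∀ i, tsupport (χ i) ⊆ physCore (sch.a k) m v (z i)) →
      (∀ i, ∀ j ≤ s, ∀ y, (sch.a k * cellSide m) ^ j * ‖iteratedFDeriv ℝ j (χ i) y‖ ≤ M) →
      ∀ Gf : 𝓢((Fin p → EuclideanSpace ℝ (Fin 4)), ℂ),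
        ‖∑ x : Fin p → ↥(box 4 (sch.L k)), (∏ i, ((χ i (sch.a k • siteToE (↑(x i) : Site 4)) : ℝ) : ℂ)) *
            Gf (fun i => sch.a k • siteToE (↑(x i) : Site 4)) *
            ((centredMoment r (sch.L k) (sch.β k) p (fun i => some (q i)) (fun i => (x i : Site 4)) : ℝ) : ℂ)‖ ≤
          (2 * C * max (sch.a k * cellSide m) (sch.a k * cellSide m)⁻¹ ^ p₀ *
              ((s + 1) * 2 ^ s * M * max 1 (sch.a k * cellSide m) ^ s) * K) ^ p * schwartzNorm (p * t) Gf))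
    (hFlat : (∀ (p n M K : ℕ) (F : 𝓢((Fin p → EuclideanSpace ℝ (Fin 4)), ℂ)), IsOffDiagonal F →
        ∀ (w : (Fin p → EuclideanSpace ℝ (Fin 4)) → ℝ) (A D δ d : ℝ), ContDiff ℝ ∞ w → HasCompactSupport w →
          0 ≤ A → 0 ≤ D → 0 ≤ δ → 0 ≤ d →
          (∀ i ≤ n, ∀ y : (Fin p → EuclideanSpace ℝ (Fin 4)), ‖iteratedFDeriv ℝ i w y‖ ≤ A * D ^ i) →
          (∀ y ∈ tsupport w, ∃ i j : Fin p, i ≠ j ∧ ‖y i - y j‖ ≤ δ) →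
          (∀ y ∈ tsupport w, d ≤ ‖y‖) →
          schwartzNorm n (SchwartzMap.smulLeftCLM ℂ (fun y : (Fin p → EuclideanSpace ℝ (Fin 4)) => ((w y : ℝ) : ℂ)) F) ≤
            A * (2 * max 1 D) ^ n * 2 ^ (K + 1) * δ ^ M * ((1 + d) ^ K)⁻¹ * schwartzNorm (n + M + K) F))
    (hPB : ∀ (f : Fin p → 𝓢(EuclideanSpace ℝ (Fin 4), ℝ)) (F' : 𝓢((Fin p → EuclideanSpace ℝ (Fin 4)), ℂ)),
      (∀ i, tsupport (f i) ⊆ physCore (sch.a k) m v (z i)) → IsTensorOf F' (fun i => ofRealTest (f i)) →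
      ‖canonDistribution r sch k p (fun i => plaq r (q i)) F'‖ ≤
        ∏ i, C * max (sch.a k * cellSide m) (sch.a k * cellSide m)⁻¹ ^ p₀ * cellNorm s (sch.a k * cellSide m) (f i))
    (hχsupp : ∀ i : Fin p, tsupport (ptuChiFun (sch.a k) m p v (z i)) ⊆ physCore (sch.a k) m v (z i))
    (hχbd : ∀ (i : Fin p) (j : ℕ) (u : EuclideanSpace ℝ (Fin 4)),
      (sch.a k * cellSide m) ^ j * ‖iteratedFDeriv ℝ j (ptuChiFun (sch.a k) m p v (z i)) u‖ ≤
        c₂ * (c₂ * ((p : ℝ) + 1) * ((j : ℝ) + 1) ^ 4) ^ j)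
    (hwC : ContDiff ℝ ∞ (ptuWeight (sch.a k) (sch.L k) p m v z))
    (hwK : HasCompactSupport (ptuWeight (sch.a k) (sch.L k) p m v z))
    (hwsupp : tsupport (ptuWeight (sch.a k) (sch.L k) p m v z) ⊆ tsupport (ptuPhiTilde (sch.a k) m p v z))
    (hwbd : ∀ (n : ℕ) (y : (Fin p → EuclideanSpace ℝ (Fin 4))), ‖iteratedFDeriv ℝ n (ptuWeight (sch.a k) (sch.L k) p m v z) y‖ ≤
      c₂ * (c₂ * ((p : ℝ) + 1) ^ 8 * ((n : ℝ) + 1) ^ 8 / (sch.a k * cellSide m)) ^ n)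
    (hgeo : ∀ y : (Fin p → EuclideanSpace ℝ (Fin 4)), y ∈ tsupport (ptuPhiTilde (sch.a k) m p v z) →
      (∃ i j : Fin p, i ≠ j ∧ ‖y i - y j‖ ≤ 240 * (sch.a k * cellSide m)) ∧
      ∀ (i : Fin p) (μ : Fin 4), sch.a k * ((v μ : ℝ) + cellSide m * (z i μ : ℝ)) ≤ y i μ ∧
        y i μ ≤ sch.a k * ((v μ : ℝ) + cellSide m * ((z i μ : ℝ) + 1)))
    (hsep : ∃ i j : Fin p, i ≠ j ∧ (16 : ℝ) ≤ ‖z i - z j‖) (M' K₂ : ℕ) :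
    ‖∑ x : Fin p → ↥(box 4 (sch.L k)),
        (∏ i, ((ptuChi (sch.a k) m p v (z i) (sch.a k • siteToE (↑(x i) : Site 4)) : ℝ) : ℂ)) *
          (SchwartzMap.smulLeftCLM ℂ
              (fun y : (Fin p → EuclideanSpace ℝ (Fin 4)) => ((ptuWeight (sch.a k) (sch.L k) p m v z y : ℝ) : ℂ)) F)
            (fun i => sch.a k • siteToE (↑(x i) : Site 4)) *
          ((centredMoment r (sch.L k) (sch.β k) p (fun i => some (q i)) (fun i => (x i : Site 4)) : ℝ) : ℂ)‖ ≤
      (2 * C * max (sch.a k * cellSide m) (sch.a k * cellSide m)⁻¹ ^ p₀ *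
          ((s + 1) * 2 ^ s * (max c₂ 1 * (max c₂ 1 * ((p : ℝ) + 1) * ((s : ℝ) + 1) ^ 4) ^ s) * max 1 (sch.a k * cellSide m) ^ s) * K) ^ p *
        (max c₂ 1 * (2 * max 1 ((max c₂ 1 * ((p : ℝ) + 1) ^ 8 * ((p : ℝ) * t + 1) ^ 8) / (sch.a k * cellSide m))) ^ (p * t) * 2 ^ ((6 * p + K₂) + 1) *
          (240 * (sch.a k * cellSide m)) ^ M' *
          ((1 + max ‖(fun i : Fin p => (WithLp.toLp 2 (fun μ : Fin 4 => max (sch.a k * ((v μ : ℝ) + cellSide m * (z i μ : ℝ))) (min 0 (sch.a k * ((v μ : ℝ) + cellSide m * ((z i μ : ℝ) + 1))))) : EuclideanSpace ℝ (Fin 4)))‖ (7 * (sch.a k * cellSide m))) ^ (6 * p + K₂))⁻¹ *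
          schwartzNorm (p * t + M' + (6 * p + K₂)) F) := by
  have hc1 : 1 ≤ max c₂ 1 := le_max_right _ _
  have hM0 : 0 ≤ (max c₂ 1 * (max c₂ 1 * ((p : ℝ) + 1) * ((s : ℝ) + 1) ^ 4) ^ s) := by positivity
  have ha : 0 < sch.a k := sch.a_pos k
  have hℓ : 0 < sch.a k * cellSide m := ptuKit_ell_pos ha m
  have hc₂le : c₂ ≤ max c₂ 1 := le_max_left _ _
  have hp1 : (1 : ℝ) ≤ (p : ℝ) + 1 := by linarith [(Nat.cast_nonneg p : (0 : ℝ) ≤ p)]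
  -- the inner cut-offs as Schwartz maps, their supports and bounds
  have hfun : ∀ i : Fin p, (⇑(ptuChi (sch.a k) m p v (z i)) : EuclideanSpace ℝ (Fin 4) → ℝ) = ptuChiFun (sch.a k) m p v (z i) :=
    fun i => rfl
  have hχsupp' : ∀ i : Fin p, tsupport (ptuChi (sch.a k) m p v (z i)) ⊆ physCore (sch.a k) m v (z i) :=
    fun i => by rw [hfun i]; exact hχsupp i
  have hχbd' : ∀ (i : Fin p), ∀ j ≤ s, ∀ u : EuclideanSpace ℝ (Fin 4),
      (sch.a k * cellSide m) ^ j * ‖iteratedFDeriv ℝ j (ptuChi (sch.a k) m p v (z i)) u‖ ≤ (max c₂ 1 * (max c₂ 1 * ((p : ℝ) + 1) * ((s : ℝ) + 1) ^ 4) ^ s) := by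
    intro i j hj u
    rw [hfun i]
    refine (hχbd i j u).trans ?_
    have hb : c₂ * ((p : ℝ) + 1) * ((j : ℝ) + 1) ^ 4 ≤ max c₂ 1 * ((p : ℝ) + 1) * ((s : ℝ) + 1) ^ 4 := by
      have hjs : (j : ℝ) + 1 ≤ (s : ℝ) + 1 := by exact_mod_cast Nat.succ_le_succ hj
      gcongr
    have hb1 : (1 : ℝ) ≤ max c₂ 1 * ((p : ℝ) + 1) * ((s : ℝ) + 1) ^ 4 := by
      have h3 : (1 : ℝ) ≤ ((s : ℝ) + 1) ^ 4 := one_le_pow₀ (by linarith [(Nat.cast_nonneg s : (0 : ℝ) ≤ s)])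
      calc (1 : ℝ) = 1 * 1 * 1 := by ring
        _ ≤ max c₂ 1 * ((p : ℝ) + 1) * ((s : ℝ) + 1) ^ 4 := by gcongr
    exact mul_le_mul hc₂le (ptuKit_pow_le_pow (by positivity) hb hb1 hj) (by positivity) (by positivity)
  -- the engine
  have hE := hLB G r sch k p q m v z C (max c₂ 1 * (max c₂ 1 * ((p : ℝ) + 1) * ((s : ℝ) + 1) ^ 4) ^ s) p₀ (fun i => ptuChi (sch.a k) m p v (z i)) hC hM0 hPB
    hχsupp' hχbd' (SchwartzMap.smulLeftCLM ℂ
      (fun y : (Fin p → EuclideanSpace ℝ (Fin 4)) => ((ptuWeight (sch.a k) (sch.L k) p m v z y : ℝ) : ℂ)) F)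
  -- the flat/decay bound for the weight
  have hwbd' : ∀ i ≤ p * t, ∀ y : (Fin p → EuclideanSpace ℝ (Fin 4)),
      ‖iteratedFDeriv ℝ i (ptuWeight (sch.a k) (sch.L k) p m v z) y‖ ≤
        max c₂ 1 * ((max c₂ 1 * ((p : ℝ) + 1) ^ 8 * ((p : ℝ) * t + 1) ^ 8) / (sch.a k * cellSide m)) ^ i := by
    intro i hi y
    refine (hwbd i y).trans ?_
    have hi' : (i : ℝ) + 1 ≤ (p : ℝ) * t + 1 := by
      have : ((i : ℕ) : ℝ) ≤ ((p * t : ℕ) : ℝ) := by exact_mod_cast hi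
      push_cast at this; linarith
    have hb : c₂ * ((p : ℝ) + 1) ^ 8 * ((i : ℝ) + 1) ^ 8 / (sch.a k * cellSide m) ≤
        (max c₂ 1 * ((p : ℝ) + 1) ^ 8 * ((p : ℝ) * t + 1) ^ 8) / (sch.a k * cellSide m) := by
      gcongr
    exact mul_le_mul hc₂le (pow_le_pow_left₀ (by positivity) hb i) (by positivity) (by positivity)
  have hwclose : ∀ y ∈ tsupport (ptuWeight (sch.a k) (sch.L k) p m v z),
      ∃ i j : Fin p, i ≠ j ∧ ‖y i - y j‖ ≤ 240 * (sch.a k * cellSide m) := fun y hy => (hgeo y (hwsupp hy)).1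
  obtain ⟨i₀, j₀, -, hz⟩ := hsep
  have hwfar : ∀ y ∈ tsupport (ptuWeight (sch.a k) (sch.L k) p m v z),
      max ‖(fun i : Fin p => (WithLp.toLp 2 (fun μ : Fin 4 => max (sch.a k * ((v μ : ℝ) + cellSide m * (z i μ : ℝ))) (min 0 (sch.a k * ((v μ : ℝ) + cellSide m * ((z i μ : ℝ) + 1))))) : EuclideanSpace ℝ (Fin 4)))‖ (7 * (sch.a k * cellSide m)) ≤ ‖y‖ := fun y hy =>
    max_le (ptuFar_norm_boxPoint_le (sch.a k) m p v z (hgeo y (hwsupp hy)).2)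
      (ptuFar_seven_ell_le (sch.a k) m p v z y i₀ j₀ ha (hgeo y (hwsupp hy)).2 hz)
  have hFl := hFlat p (p * t) M' (6 * p + K₂) F hF (ptuWeight (sch.a k) (sch.L k) p m v z) (max c₂ 1)
    ((max c₂ 1 * ((p : ℝ) + 1) ^ 8 * ((p : ℝ) * t + 1) ^ 8) / (sch.a k * cellSide m)) (240 * (sch.a k * cellSide m))
    (max ‖(fun i : Fin p => (WithLp.toLp 2 (fun μ : Fin 4 => max (sch.a k * ((v μ : ℝ) + cellSide m * (z i μ : ℝ))) (min 0 (sch.a k * ((v μ : ℝ) + cellSide m * ((z i μ : ℝ) + 1))))) : EuclideanSpace ℝ (Fin 4)))‖ (7 * (sch.a k * cellSide m))) hwC hwK (by positivity) (by positivity)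
    (by positivity) (le_max_of_le_left (norm_nonneg _)) hwbd' hwclose hwfar
  -- combine
  have hXnn : 0 ≤ 2 * C * max (sch.a k * cellSide m) (sch.a k * cellSide m)⁻¹ ^ p₀ *
      ((s + 1) * 2 ^ s * (max c₂ 1 * (max c₂ 1 * ((p : ℝ) + 1) * ((s : ℝ) + 1) ^ 4) ^ s) * max 1 (sch.a k * cellSide m) ^ s) * K := by positivity
  exact hE.trans (mul_le_mul_of_nonneg_left hFl (pow_nonneg hXnn p))

end Piece

end Summit.QuantumFields.YangMills.Theorems.ContinuumLegGivenGap

end
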